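/-
rh-inputs cell (A1), prover-3, 2026-08-28.  LADDER-RH bookkeeping: item [24464]
`ScrewPolyaSigns.PolyaLandauR` closed UNCONDITIONALLY from the discharged named fact
`Grosswald1967_thmB` (now a theorem: `Grosswald1967_thmB_holds`).  `PolyaLandauR` is a theorem of
classical analysis (Pólya–Landau–Grosswald); nothing in this file bears on the truth of RH.
-/
import Literature.NumberTheory.LFunctions.PolyaSignChangesHolds
import Summits.RiemannHypothesis.RiemannHypothesis.Theses.ScrewPolyaSigns

/-!
# [24464] `ScrewPolyaSigns.PolyaLandauR` — proved

Item stmt-RiemannHypothesis-24464 (`Summit.RiemannHypothesis.RiemannHypothesis.Theses.ScrewPolyaSigns.PolyaLandauR`,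
route `ScrewPolyaSigns`: the quantitative one-sided Pólya–Landau sign-change bound in the
holomorphic-extension form) is PROVED: the named fact `Grosswald1967_thmB` is now the theorem
`Literature.NumberTheory.LFunctions.PolyaSignChanges.Grosswald1967_thmB_holds`
(`PolyaSignChangesHolds.lean`, assembling `pieceA` + `pieceB` of the A1 moment-method architecture:
`PolyaSignChangesMomentDefs`, `…Laguerre(Chains)`, `…PolePair(Asymptotics)`, `…Truncation`,
`…Blocks`, `…PieceA`, `…Counting`, `…PoleLemmas`, `…NearestPole`, `…InfiniteHeight`), and the
item follows through the Literature corollary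
`Grosswald1967_thmB.exists_holomorphic_extension_of_chain_bound` — the same term as the landed
conditional theorem `polyaLandauR_of_grosswald1967 (h : Grosswald1967_thmB) : PolyaLandauR`
(`ScrewPolyaSignsPolyaLandauROfGrosswald.lean`), which this file does not import so as to stay off
the Theorems→Theses cone (gate lint `theses-cone`); `polyaLandauR_proof` is definitionally
`polyaLandauR_of_grosswald1967 Grosswald1967_thmB_holds`.

HONEST LABEL: this closes a crux that is a theorem of classical analysis (RH-free); on the S20 line
`closes (h₁ PolyaLandauR) (h₂ ScrewSignSparse) (hA AssemblyR)` the remaining binder `ScrewSignSparse`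
is RH-implied.  Nothing here bears on the truth of RH.
-/

-- D-0017: `Summit.RiemannHypothesis.RiemannHypothesis.…` duplicates the namespace BY DESIGN (single-problem summit).
set_option linter.dupNamespace false

namespace Summit.RiemannHypothesis.RiemannHypothesis.Theorems

open Literature.NumberTheory.LFunctions.PolyaSignChanges in
/-- **[24464] `PolyaLandauR`, unconditional.**  A real `g` on `(1, ∞)` whose alternating sign
chains in `(1, X]` have length `≤ D log X + B`, and whose Mellin transform `mellinIoi g` continues
meromorphically to `{θ − b < re}` and holomorphically on `{θ < re} ∪ {θ − η < re, |im| < πD + η}`,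
has a holomorphic continuation to some half-plane `{θ − ε < re}`, `ε > 0` — by Pólya's sign-change
theorem (`Grosswald1967_thmB_holds`) through its contrapositive corollary
`Grosswald1967_thmB.exists_holomorphic_extension_of_chain_bound` (the `ContinuousOn g` hypothesis of
`PolyaLandauR` is not needed and is dropped, `_`). [cite: Grosswald1967, §4 Theorem B, pp. 4–5] -/
theorem polyaLandauR_proof :
    Summit.RiemannHypothesis.RiemannHypothesis.Theses.ScrewPolyaSigns.PolyaLandauR :=
  fun g σ₁ θ b η D B _ hint hchain hθ hb hη Φ hmer hhol heq =>
    Grosswald1967_thmB_holds.exists_holomorphic_extension_of_chain_bound g σ₁ θ b η D B hint hchain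
      hθ hb hη Φ hmer hhol heq

end Summit.RiemannHypothesis.RiemannHypothesis.Theorems
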